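import Summits.SmoothPoincare4.SmoothPoincare4.Theorems.EntropyRungChangGurskyYangStubSmoothRoundLimitAux
import HarnessLib

/-!
# The continuous limit of the scaled metrics `g(t)/(T − t)` (Hamilton 1982, Lemma 14.2)
(helper file 2 for stub `stub_smoothRoundLimit`, line `margerin-cone-hamilton-rails`, crux
`EntropyRung.ChangGurskyYang`, item stmt-SmoothPoincare4-10834)

Along a Ricci flow of Riemannian metrics `g(t)` on `[0, T)` on a manifold with `4`-dimensional
model, with the roundness rates `|(T−t)R − 2| ≤ C (T−t)^δ` and
`(T−t)² (|Ric|² − R²/4) ≤ C (T−t)^{2δ}` on `[t₀, T)` (`δ > 0`), the scaled metrics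
`g̃(t) = g(t)/(T−t)` converge at every point and on every pair of vectors, as `t ↑ T`, to a
symmetric positive definite bilinear form `g'`, with the two-sided rate
`e^{−(κ/δ)(T−t)^δ} g̃_t(X,X) ≤ g'(X,X) ≤ e^{(κ/δ)(T−t)^δ} g̃_t(X,X)`, `κ = (C² + 4C)^{1/2}`
(`helper_scaledMetric_tendsto`, the registered helper). Proof (Hamilton 1982, §14, Lemma 14.2
and §17, Thm. 17.6): `φ(t) = g_t(X,X)` has `φ' = −2Ric_t(X,X)` (the flow equation) and
`|(T−t)φ' + φ| = |g − 2(T−t)Ric|(X,X) ≤ κ (T−t)^δ φ` (`abs_sub_two_mul_apply_le` of the first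
helper file), so the logarithmic Grönwall lemma `logGronwall` of that file applies; polarisation
gives the off-diagonal limits.

## References

* R. S. Hamilton, *Three-manifolds with positive Ricci curvature*, J. Differential Geom. 17
  (1982) 255–306, §14, Lemma 14.2; §17, Thm. 17.6. [Hamilton1982]
* A. L. Besse, *Einstein manifolds*, Springer 1987, 1.118. [Besse1987]
-/

noncomputable section

-- every `Summit.SmoothPoincare4.SmoothPoincare4.…` name repeats the summit = sub-problem segment (D-0017 layout)
set_option linter.dupNamespace false

open Set Function Filter Real Module
open scoped Manifold ContDiff Topology

namespace Summit.SmoothPoincare4.SmoothPoincare4.Theorems.MargerinRails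

open Literature.Geometry.Riemannian
open Literature.Geometry.Lorentzian Literature.Geometry.Lorentzian.PseudoRiemannianMetric

section ScaledLimit

variable {M : Type*} [TopologicalSpace M] [ChartedSpace (EuclideanSpace ℝ (Fin 4)) M]
  [IsManifold (𝓡 4) ∞ M]
  {g : ℝ → PseudoRiemannianMetric (𝓡 4) ∞ (EuclideanSpace ℝ (Fin 4)) (TangentSpace (𝓡 4) : M → Type _)}
  {cov : ℝ → CovariantDerivative (𝓡 4) (EuclideanSpace ℝ (Fin 4)) (TangentSpace (𝓡 4) : M → Type _)}
  {T δ C t₀ : ℝ}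

/-- **The diagonal case of Hamilton's Lemma 14.2 for the scaled metric**: along a Ricci flow of
Riemannian metrics on `[0, T)` with the two roundness rates on `[t₀, T)`, for every tangent vector
`X ≠ 0` the function `t ↦ g_t(X,X)/(T−t)` obeys the two-sided logarithmic Grönwall control with
rate `κ (T−t)^{δ−1}`, `κ = (C² + 4C)^{1/2}`, and has a positive limit as `t ↑ T` within the
two-sided envelope. [cite: Hamilton1982, §14, Lemma 14.2] [cite: Hamilton1982, §17, Thm. 17.6] -/
theorem scaledMetric_tendsto_diag (hflow : IsRicciFlow g cov (Ico 0 T))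
    (hR : ∀ t ∈ Ico 0 T, (g t).IsRiemannian) (hδ : 0 < δ) (ht₀ : t₀ ∈ Ico 0 T)
    (hrate : ∀ t ∈ Ico t₀ T, ∀ x : M,
      |(T - t) * (g t).scalarCurvatureWith (cov t) x - 2| ≤ C * (T - t) ^ δ ∧
      (T - t) ^ 2 * ((g t).normSq x ((cov t).ricci x) -
        (g t).scalarCurvatureWith (cov t) x ^ 2 / 4) ≤ C * (T - t) ^ (2 * δ))
    (x : M) {X : TangentSpace (𝓡 4) x} (hX : X ≠ 0) :
    ∃ ℓ : ℝ, 0 < ℓ ∧ Tendsto (fun t ↦ (g t).val x X X / (T - t)) (𝓝[<] T) (𝓝 ℓ) ∧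
      ∀ t ∈ Ico t₀ T,
        exp (-(Real.sqrt (C ^ 2 + 4 * C) / δ * (T - t) ^ δ)) * ((g t).val x X X / (T - t)) ≤ ℓ ∧
        ℓ ≤ exp (Real.sqrt (C ^ 2 + 4 * C) / δ * (T - t) ^ δ) * ((g t).val x X X / (T - t)) := by
  have hsub : Ico t₀ T ⊆ Ico 0 T := fun t ht ↦ ⟨ht₀.1.trans ht.1, ht.2⟩
  have h4 : finrank ℝ (EuclideanSpace ℝ (Fin 4)) = 4 := finrank_euclideanSpace_fin
  -- `C ≥ 0` (test the first rate at `t₀`, `x`)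
  have hC : 0 ≤ C := by
    have h1 := (hrate t₀ ⟨le_rfl, ht₀.2⟩ x).1
    have h2 : 0 < (T - t₀) ^ δ := rpow_pos_of_pos (sub_pos.2 ht₀.2) δ
    exact nonneg_of_mul_nonneg_left ((abs_nonneg _).trans h1) h2
  -- the derivative bound `|(T−t)φ' + φ| ≤ κ (T−t)^δ φ`
  have hbd : ∀ t ∈ Ico t₀ T,
      |(T - t) * (-2 * (cov t).ricci x X X) + (g t).val x X X| ≤
        Real.sqrt (C ^ 2 + 4 * C) * (T - t) ^ δ * (g t).val x X X := by
    intro t ht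
    have hTt : 0 < T - t := sub_pos.2 ht.2
    obtain ⟨h₁, h₂⟩ := hrate t ht x
    have key := abs_sub_two_mul_apply_le (g t) (hR t (hsub ht)) h4 x ((cov t).ricci x)
      (s := T - t) h₁ h₂ X
    have hsqrt : Real.sqrt ((C * (T - t) ^ δ) ^ 2 + 4 * (C * (T - t) ^ (2 * δ))) =
        Real.sqrt (C ^ 2 + 4 * C) * (T - t) ^ δ := by
      have h2δ : (T - t) ^ (2 * δ) = ((T - t) ^ δ) ^ 2 := by
        rw [mul_comm, rpow_mul hTt.le, rpow_two]
      rw [h2δ, show (C * (T - t) ^ δ) ^ 2 + 4 * (C * ((T - t) ^ δ) ^ 2) =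
        (C ^ 2 + 4 * C) * ((T - t) ^ δ) ^ 2 by ring, Real.sqrt_mul (by positivity),
        Real.sqrt_sq (rpow_nonneg hTt.le δ)]
    rw [hsqrt] at key
    have hrw : (T - t) * (-2 * (cov t).ricci x X X) + (g t).val x X X =
        (g t).val x X X - 2 * (T - t) * (cov t).ricci x X X := by ring
    rw [hrw]
    exact key
  exact (logGronwall (φ := fun t ↦ (g t).val x X X) (φ' := fun t ↦ -2 * (cov t).ricci x X X)
    hδ ht₀.2 (fun t ht ↦ (hflow.hasDerivWithinAt t (hsub ht) x X X).mono hsub)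
    (fun t ht ↦ hR t (hsub ht) x X hX) hbd).2

/-- **HELPER `helper_scaledMetric_tendsto` — the continuous limit of `g(t)/(T−t)`** (Hamilton
1982, §14, Lemma 14.2 in the unnormalised clothes of §17, Thm. 17.6): along a Ricci flow of
Riemannian metrics on `[0, T)` with the two roundness rates on `[t₀, T)`, at every point `x` the
scaled forms `g_t(x)/(T−t)` converge as `t ↑ T`, on every pair of vectors, to a symmetric
positive definite bilinear form `g'_x`, with
`e^{−(κ/δ)(T−t)^δ} g̃_t(X,X) ≤ g'_x(X,X) ≤ e^{(κ/δ)(T−t)^δ} g̃_t(X,X)` (`κ = (C² + 4C)^{1/2}`):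
the diagonal by `scaledMetric_tendsto_diag` (logarithmic Grönwall), the rest by polarisation.
[cite: Hamilton1982, §14, Lemma 14.2] [cite: Hamilton1982, §17, Thm. 17.6] [cite: Besse1987, 1.118] -/
theorem helper_scaledMetric_tendsto : ∀ (M : Type) [TopologicalSpace M] [ChartedSpace (EuclideanSpace ℝ (Fin 4)) M] [IsManifold (𝓡 4) ∞ M] (g : ℝ → PseudoRiemannianMetric (𝓡 4) ∞ (EuclideanSpace ℝ (Fin 4)) (TangentSpace (𝓡 4) : M → Type _)) (cov : ℝ → CovariantDerivative (𝓡 4) (EuclideanSpace ℝ (Fin 4)) (TangentSpace (𝓡 4) : M → Type _)) (T : ℝ), IsRicciFlow g cov (Ico 0 T) → (∀ t ∈ Ico 0 T, (g t).IsRiemannian) → ∀ (δ C t₀ : ℝ), 0 < δ → t₀ ∈ Ico 0 T → (∀ t ∈ Ico t₀ T, ∀ x : M, |(T - t) * (g t).scalarCurvatureWith (cov t) x - 2| ≤ C * (T - t) ^ δ ∧ (T - t) ^ 2 * ((g t).normSq x ((cov t).ricci x) - (g t).scalarCurvatureWith (cov t) x ^ 2 / 4) ≤ C * (T - t) ^ (2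 * δ)) → ∀ x : M, ∃ gT : LinearMap.BilinForm ℝ (TangentSpace (𝓡 4) x), (∀ X Y, Tendsto (fun t ↦ (g t).val x X Y / (T - t)) (𝓝[<] T) (𝓝 (gT X Y))) ∧ (∀ X Y, gT X Y = gT Y X) ∧ (∀ X, X ≠ 0 → 0 < gT X X) ∧ ∀ t ∈ Ico t₀ T, ∀ X, Real.exp (-(Real.sqrt (C ^ 2 + 4 * C) / δ * (T - t) ^ δ)) * ((g t).val x X X / (T - t)) ≤ gT X X ∧ gT X X ≤ Real.exp (Real.sqrt (C ^ 2 + 4 * C) / δ * (T - t) ^ δ) * ((g t).val x X X / (T - t)) := by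
  intro M _ _ _ g cov T hflow hR δ C t₀ hδ ht₀ hrate x
  -- diagonal limits (with `0` for the zero vector)
  have hdiag : ∀ X : TangentSpace (𝓡 4) x, ∃ ℓ : ℝ,
      Tendsto (fun t ↦ (g t).val x X X / (T - t)) (𝓝[<] T) (𝓝 ℓ) ∧ (X ≠ 0 → 0 < ℓ) ∧
      ∀ t ∈ Ico t₀ T,
        exp (-(Real.sqrt (C ^ 2 + 4 * C) / δ * (T - t) ^ δ)) * ((g t).val x X X / (T - t)) ≤ ℓ ∧
        ℓ ≤ exp (Real.sqrt (C ^ 2 + 4 * C) / δ * (T - t) ^ δ) * ((g t).val x X X / (T - t)) := by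
    intro X
    by_cases hX : X = 0
    · subst hX
      refine ⟨0, ?_, fun h ↦ absurd rfl h, fun t _ ↦ ?_⟩
      · simp only [map_zero, zero_div]
        exact tendsto_const_nhds
      · simp
    · obtain ⟨ℓ, hℓ, hlim, hbd⟩ := scaledMetric_tendsto_diag hflow hR hδ ht₀ hrate x hX
      exact ⟨ℓ, hlim, fun _ ↦ hℓ, hbd⟩
  choose ℓ hℓlim hℓpos hℓbd using hdiag
  -- the candidate: pointwise limits, by polarisation
  set f : TangentSpace (𝓡 4) x → TangentSpace (𝓡 4) x → ℝ :=
    fun X Y ↦ (ℓ (X + Y) - ℓ X - ℓ Y) / 2 with hf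
  have hconv : ∀ X Y, Tendsto (fun t ↦ (g t).val x X Y / (T - t)) (𝓝[<] T) (𝓝 (f X Y)) := by
    intro X Y
    have hpol : (fun t ↦ (g t).val x X Y / (T - t)) = fun t ↦
        ((g t).val x (X + Y) (X + Y) / (T - t) - (g t).val x X X / (T - t) -
          (g t).val x Y Y / (T - t)) / 2 := by
      funext t
      simp only [map_add, add_apply, (g t).symm x Y X]
      ring
    rw [hpol]
    exact (((hℓlim (X + Y)).sub (hℓlim X)).sub (hℓlim Y)).div_const 2
  have hdiag' : ∀ X, f X X = ℓ X := fun X ↦ tendsto_nhds_unique (hconv X X) (hℓlim X)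
  have hsymm : ∀ X Y, f X Y = f Y X := fun X Y ↦ by
    have : (fun t ↦ (g t).val x X Y / (T - t)) = fun t ↦ (g t).val x Y X / (T - t) :=
      funext fun t ↦ by rw [(g t).symm x X Y]
    exact tendsto_nhds_unique (hconv X Y) (this ▸ hconv Y X)
  have hadd : ∀ X X' Y, f (X + X') Y = f X Y + f X' Y := fun X X' Y ↦
    tendsto_nhds_unique (hconv (X + X') Y)
      (by simpa only [map_add, add_apply, add_div]
        using (hconv X Y).add (hconv X' Y))
  have hsmul : ∀ (c : ℝ) X Y, f (c • X) Y = c * f X Y := fun c X Y ↦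
    tendsto_nhds_unique (hconv (c • X) Y)
      (by simpa only [map_smul, FunLike.coe_smul, Pi.smul_apply, smul_eq_mul,
        mul_div_assoc] using (hconv X Y).const_mul c)
  let gT : LinearMap.BilinForm ℝ (TangentSpace (𝓡 4) x) :=
    LinearMap.mk₂ ℝ f hadd hsmul
      (fun X Y Y' ↦ by rw [hsymm, hadd, hsymm Y, hsymm Y'])
      (fun c X Y ↦ by rw [smul_eq_mul, hsymm, hsmul, hsymm Y])
  have hgT : ∀ X Y, gT X Y = f X Y := fun X Y ↦ rfl
  refine ⟨gT, fun X Y ↦ hgT X Y ▸ hconv X Y,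
    fun X Y ↦ (hgT X Y).trans ((hsymm X Y).trans (hgT Y X).symm), fun X hX ↦ ?_, fun t ht X ↦ ?_⟩
  · rw [hgT, hdiag']
    exact hℓpos X hX
  · rw [hgT, hdiag']
    exact hℓbd X t ht

end ScaledLimit

end Summit.SmoothPoincare4.SmoothPoincare4.Theorems.MargerinRails

end
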